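import Mathlib
import HarnessLib
import Summits.HubbardSuperconductivity.HubbardSuperconductivity.Theorems.KLProgrammeKLRegimeTwoVolumeTowerSpineDefs

/-!
# Route `KLProgramme` — crux K3, VL child `KLRegimeVolumeLimitV17F2` (stmt-HubbardSuperconductivity-20440), blueprint v5 M5 / W7: THE ONE-VOLUME DATA PACKAGE
# OF THE NESTED TWO-VOLUME INDUCTION (definition; seat hubbard-kl-k3c4-p1 g13; `--supports` 20440; definition lane)

`…TwoVolumeTowerSpine` (W5), `…TwoVolumeTowerEnd` (W6b) and `…TwoVolumeTowerEndDoor` (W6c) compose, for FIXED `(β, U, μ)`, into the inner text of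
k3c5-p3's door `…VolumeLimitV9GluedSrcPairDoorAt.stub_vl_nestedFramed_of_gluedSrcDefect_keyedAt` once their hypotheses are supplied at the flow frames
`K_V = klFlowFrameU V M β U μ (nScales β + 1)`, `J = nScales β`, `ε_M = imagTimeWeight β M`.  This file bundles those hypotheses — the volume-free
constants and budgets of every scale with their signs, the raw-budget recursion, the volume-free smallness `TowerScaleSmall`, the frame-mismatch rates, the
three data bundles `TowerVolumeData`/`TowerCrossData` eventually in `L` at every admissible instance `Mth L b ≤ M`, and the BASE (the keyed defect of the
step-`0` read-outs at the `2r_L`-deep pins tends to zero) — into ONE `Type`-valued structure `TowerData β U μ`, the single target of the M3b-j data dischargers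
(E1's sub-diagonal read-outs, p3's covariance/overlap bundles, k3c4-p2's frame differences, the scale-`0` base).  `…TwoVolumeTowerCloser` proves
`TowerData β U μ → (door's inner text)` and the registered stub from `Nonempty (TowerData β U μ)` under the regime.

* **`TowerData β U μ`**.

Definition only (a structure of data and proofs); nothing about the model is asserted.
-/

noncomputable section

namespace Summit.HubbardSuperconductivity.HubbardSuperconductivity.Theorems.TwoVolumeSource

set_option linter.dupNamespace false -- summit = problem name (single-conjunct summit), D-0017

open Finset Filter Topology Literature.MathematicalPhysics.QuantumLattice GrassmannAlgebra Literature.Probability.LatticeModels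
  Literature.Probability.LatticeModels.BattleFederbush
open Summit.HubbardSuperconductivity.HubbardSuperconductivity.Theorems.TwoPointAssembly
open Summit.HubbardSuperconductivity.HubbardSuperconductivity.Theorems.KLRegimeSplit
open Summit.HubbardSuperconductivity.HubbardSuperconductivity.Theorems.KLProgrammeLegKernels
open Summit.HubbardSuperconductivity.HubbardSuperconductivity.Theorems.EngineV8
open Summit.HubbardSuperconductivity.HubbardSuperconductivity.Theorems.TwoVolumeDefect

/-- **`TowerData β U μ`** — the one-volume data package of the nested two-volume induction at `(β, U, μ)` (see the module docstring): constants, budgets,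
smallness, mismatch rates, the three data bundles eventually in `L`, and the base. -/
structure TowerData (β U μ : ℝ) where
  /-- Matsubara-cutoff threshold of an admissible instance `(L, b, M)`: `Mth L b ≤ M` -/
  Mth : ℕ → ℕ → ℕ
  /-- the depth schedule `r_L → ∞` with `2·(2(J+1)·r_L + r_L) < L`, `J = nScales β` -/
  r : ℕ → ℕ
  hr : Tendsto r atTop atTop
  hRd : ∀ L, 0 < L → 2 * (2 * (nScales β + 1) * r L + r L) < L
  /-- volume-free constants per scale -/
  Λ : ℕ → ℝ
  κ : ℕ → ℝ
  aW : ℕ → ℝ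
  sW : ℕ → ℝ
  κ' : ℕ → ℝ
  aW' : ℕ → ℝ
  sW' : ℕ → ℝ
  eW' : ℕ → ℝ
  ΛT : ℕ → ℝ
  cW : ℕ → ℝ
  κf : ℕ → ℝ
  cRb : ℕ → ℝ
  cCb : ℕ → ℝ
  δb : ℕ → ℝ
  ρ₀ : ℕ → ℝ
  ρf : ℕ → ℝ
  ρ₂ : ℕ → ℝ
  ρ' : ℕ → ℝ
  ρ₃ : ℕ → ℝ
  ν₀ : ℕ → ℝ
  ν₁ : ℕ → ℝ
  ν₂ : ℕ → ℝ
  ν₃ : ℕ → ℝ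
  ν₄ : ℕ → ℝ
  ν₅ : ℕ → ℝ
  νE : ℕ → ℝ
  ν₆ : ℕ → ℝ
  ν₇ : ℕ → ℝ
  ν₈ : ℕ → ℝ
  /-- E1's L-free even budgets `NV j m` and the raw budgets `NS j k` of the states -/
  NV : ℕ → ℕ → ℝ
  NS : ℕ → ℕ → ℝ
  /-- the frame-mismatch rates (scale `j`, coarse volume `L`) -/
  sE : ℕ → ℕ → ℝ
  cR : ℕ → ℕ → ℝ
  cC : ℕ → ℕ → ℝ
  δ : ℕ → ℕ → ℝ
  /-- (H1) signs -/
  hΛ : ∀ j, 0 < Λ j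
  hΛmono : ∀ j, Λ (j + 1) ≤ Λ j
  hΛT : ∀ j, Λ j ≤ ΛT j
  hκ : ∀ j, 0 < κ j ∧ 0 < κ' j ∧ 0 < κf j
  haW : ∀ j, 0 ≤ aW j ∧ 0 ≤ aW' j ∧ 0 ≤ sW j ∧ 0 ≤ sW' j ∧ 0 ≤ eW' j ∧ 0 ≤ cW j ∧ 0 ≤ δb j
  hρ : ∀ j, 0 < ρ₀ j ∧ 0 < ρf j ∧ 0 < ρ₂ j ∧ 0 < ρ' j ∧ 0 < ρ₃ j
  hNV0 : ∀ j m, 0 ≤ NV j m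
  hNSnn : ∀ j k, 0 ≤ NS j k
  /-- (H2) the raw-budget recursion -/
  hNS0 : ∀ k, NS 0 k = if Even k then NV 0 (k / 2) else 0
  hNSsucc : ∀ j k, j < nScales β → NS (j + 1) k = (ρ₀ j)⁻¹ ^ k * (Real.exp 1 * ν₀ j) / (1 - Real.exp 1 * aW j * ν₀ j / κ j ^ 2)
  /-- (H3) volume-free smallness of every step -/
  hsm : ∀ j, j < nScales β → TowerScaleSmall (κ j) (κ' j) (aW j) (aW' j) (cW j) (κf j) (cRb j) (cCb j) (δb j) (ρ₀ j) (ρf j) (ρ₂ j) (ρ' j) (ρ₃ j) (NV j) (NS j)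
    (ν₀ j) (ν₁ j) (ν₂ j) (ν₃ j) (ν₄ j) (ν₅ j) (νE j) (ν₆ j) (ν₇ j) (ν₈ j)
  /-- (H4) the mismatch rates: signs, caps, limits -/
  hmis : ∀ j L, 0 ≤ sE j L ∧ 0 ≤ cR j L ∧ 0 ≤ cC j L ∧ 0 ≤ δ j L ∧ cR j L ≤ cRb j ∧ cC j L ≤ cCb j ∧ δ j L ≤ δb j
  hmis0 : ∀ j, Tendsto (sE j) atTop (𝓝 0) ∧ Tendsto (cR j) atTop (𝓝 0) ∧ Tendsto (cC j) atTop (𝓝 0) ∧ Tendsto (δ j) atTop (𝓝 0)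
  /-- (H5) the three data bundles, eventually in `L`, at every admissible instance, at the flow frames -/
  hdata : ∀ᶠ L in atTop, ∀ (b M : ℕ) [NeZero L] [NeZero (b * L)] [NeZero M], Mth L b ≤ M →
    TowerVolumeData L M β U μ (klFlowFrameU L M β U μ (nScales β + 1)) (nScales β) (imagTimeWeight β M) Λ κ aW sW NV ∧
      TowerVolumeData (b * L) M β U μ (klFlowFrameU (b * L) M β U μ (nScales β + 1)) (nScales β) (imagTimeWeight β M) Λ κ aW sW NV ∧
        TowerCrossData L b M β μ (klFlowFrameU L M β U μ (nScales β + 1)) (klFlowFrameU (b * L) M β U μ (nScales β + 1)) (nScales β) (imagTimeWeight β M)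
          Λ κ' aW' sW' eW' ΛT cW κf (fun j => sE j L) (fun j => cR j L) (fun j => cC j L) (fun j => δ j L)
  /-- (H6) the BASE: the keyed defect of the step-`0` read-outs at the `2 r_L`-deep pins tends to zero uniformly in the instance -/
  h0 : ∀ (k : ℕ) (η : ℝ), 0 < η → ∀ᶠ L in atTop, ∀ (b M : ℕ) [NeZero L] [NeZero (b * L)] [NeZero M], Mth L b ≤ M →
    ∀ (p : Fin k) (w : SrcLabel (b * L) M 0), (∀ i, 2 * r L ≤ (w.1.1.2 i).val % L ∧ (w.1.1.2 i).val % L + 2 * r L < L) →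
      klKeyedDefect L b M β U μ (klFlowFrameU L M β U μ (nScales β + 1)) (klFlowFrameU (b * L) M β U μ (nScales β + 1)) 0 k p w ≤ imagTimeWeight β M * η

end Summit.HubbardSuperconductivity.HubbardSuperconductivity.Theorems.TwoVolumeSource

end
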